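import Summits.QuantumFields.BalabanUV.T4Continuum.Support.TorusHolonomySpreading
import Summits.QuantumFields.BalabanUV.T4Continuum.Support.UnitaryResolventMargin

/-!
# TorusSmallFieldGlobalGauge — BRICK B4 (ASSEMBLY) of the requested lattice lemma: **`torusSmallFieldGlobalGauge` PROVED** (INTERFACE REQUEST
# NE7, HOME/INBOX.md ll.6031–6037, route #1 of the NE7 crux, stub S7 NODE O).  On the discrete 4-torus of period `M ≥ 1`, a `U(n)` lattice gauge
# field with all plaquettes within `η` of `1`, in the sector `|n|·M²·η ≤ c₀(n)`, has a global `M`-periodic unitary gauge in which EVERY bond is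
# `exp A_b` with `‖A_b‖ ≤ C(n)·(M⁻¹ + M·η)` — constants `c₀ = |n|∕(8(|n|+1)²)`, `C` explicit in `|n|`

Cell `pub-balaban`, rung (B)+1 sub-cell t4, lineage `b2b-balaban-t4-ne7-p1`, generation 26 (CRUX PROVER NE7 #1, ruling e34b3e0c); crux
skeleton `t4/skeletons/NE7-CRUX-R1.md` v1.7.6 §4; bricks B1 `TorusGaugeComb` (p259900), B2a `UnitaryCayley` (p260933), B2b `UnitaryCayleyPath`
(p261311), B2c `UnitaryResolventMargin`, B3a `TorusLineHolonomy` (p261222), B3b `TorusHolonomySpreading` (p261381).  HONEST FRAMING (page 1): FIXED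
FINITE T⁴, rung (B)+1; NE7, NE3 NOT PRINTED in [Balaban1984PropagatorsI]–[Balaban1989LargeFieldII] and NOT PROVED here; continuum YM on T⁴ ⇐
BetaPertH ∧ nine spine estimates (0/9 proved); BetaPertH ⇐ (D1) ∧ (D4) ∧ CAP+tail; G-an2-4 gates asym, D1 and NE2/3/4; NOT infinite volume, NOT
mass gap, NOT Clay.

THE PROOF ([folklore]-TYPE globalisation of the maximal-tree gauge; NOT a statement of Bałaban's; not found in print as stated — presearch recorded
in the INTERFACE REQUEST).  (0) Comb gauge (B1): interior bonds within `3(M−1)η`.  (1)–(4) For `μ = 0, 1, 2, 3` in turn: pick by pigeonhole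
(B2c `exists_initial_margin`) a resolvent point `−scay k`, `k ≤ |n|`, with margin `s_n = (|n|+1)⁻²` for the holonomy of the `μ`-line through `0`;
the margin walk (B3b `holo_good_all`, B2c `good_mono`∕`good_conj`∕`good_pert`) puts EVERY `μ`-holonomy in `Good k (s_n∕2)` as soon as
`8M²η ≤ s_n` (this is where the SECTOR CONDITION enters); on that set the Cayley path (B2b) is a `PathFamily` (**`pathFamily_cpath`**, speed
`σ₀∕M`, Lipschitz `Λ₀`), so the spreading gauge (B3b) makes all `μ`-bonds `σ₀∕M`-small and keeps the other small bonds within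
`3δ + (1 + Λ₀)Mη` (**`direction_step`**, invariant **`Small`**).  (5) After four steps every bond is within `δ₄ ≤ C′(M⁻¹ + Mη)` of `1`, and
`MatrixLog.exists_isHermitian_exp_eq` ((23)–(25) of [Balaban1985Averaging], a PROVED tree lemma) writes it as `exp A`, `‖A‖ ≤ (π∕2)δ₄`.
END: **`torusSmallFieldGlobalGauge`** — LITERALLY the requested type.
HONEST: a finite lattice lemma about ARBITRARY unitary periodic small-field configurations; nothing of Bałaban's disputed steps is used or asserted;
it discharges ONLY the letter `hglob` of NODE O's background coordinate (consumer p259521); NE3∕NE7 NOT proved; 0 sorry.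
-/

set_option autoImplicit false

open scoped BigOperators Matrix Matrix.Norms.L2Operator
open Finset NormedSpace Complex

namespace Summit.QuantumFields.BalabanUV.T4Continuum.TorusSmallFieldGlobalGauge

open Literature.MathematicalPhysics.QuantumFieldTheory.Balaban1983to89
open B7Prop1Explicit B7Prop2Explicit
open T4AveragingDeficitWall hiding Site Plane Plaq Bond
open T4AveragingDeficitWallBoundary (IsPeriodicCfg)
open NE3EnergyShapes (IsUnitarySite IsPeriodicSite)
open AveragingDeficitTransport (mem_U1_of_unitary)
open BlockAverageCurrent (smallField_gaugeAct)
open AveragingDeficitKDatum (isUnitaryCfg_gaugeAct)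
open TorusGaugeComb (natSite wrapSite comb_gauge_box)
open SmoothRefineAbelianFlux (hol_add_period)
open TorusLineHolonomy TorusHolonomySpreading UnitaryCayley UnitaryCayleyPath UnitaryResolventMargin

noncomputable section

variable {n : Type*} [Fintype n] [DecidableEq n] [Nonempty n]

/-! ## §1 The Cayley path is a spreading path family on every positive-level good set -/

/-- **THE CAYLEY PATH FAMILY**: on `Good k s` (`s > 0`) the Cayley path `cpath M k` is a `PathFamily` for period `M ≥ 1` with speed constant
`σ = 2|k| + 4s⁻¹ + 2` and Lipschitz constant `Λ = 4s⁻²`. [folklore] -/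
theorem pathFamily_cpath {M : ℕ} (hM : 1 ≤ M) (k : ℝ) {s : ℝ} (hs : 0 < s) :
    PathFamily M (Good (n := n) k s) (cpath M k) (2 * |k| + 4 * s⁻¹ + 2) (4 * s⁻¹ ^ 2) where
  zero := fun W => cpath_zero W
  top := fun W hW => cpath_top hM (good_unitary hW) (good_isUnit hs hW)
  unitary := fun W _ t => cpath_mem t W
  speed := fun W hW t _ => by
    have hM0 : (0 : ℝ) < M := by exact_mod_cast hM
    have hg : ‖gen k W‖ ≤ 2 * s⁻¹ + 1 := by
      have h := norm_gen_le (good_isUnit hs hW)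
      rw [norm_one] at h
      exact h.trans (by linarith [good_norm_le hs hW])
    refine (cpath_speed hM (good_unitary hW) (good_isUnit hs hW) t).trans ?_
    rw [norm_one, mul_one]
    exact div_le_div_of_nonneg_right (by linarith) hM0.le
  lip := fun W hW W' hW' t ht => by
    have h1 := good_norm_le hs hW
    have h2 := good_norm_le hs hW'
    have h0 : 0 ≤ ‖(resolv k W)⁻¹‖ := norm_nonneg _
    refine (cpath_lip hM (good_unitary hW) (good_isUnit hs hW) (good_unitary hW') (good_isUnit hs hW') ht).trans ?_
    refine (mul_le_mul_of_nonneg_left (norm_gen_sub_gen_le (good_isUnit hs hW) (good_isUnit hs hW')) (by norm_num)).trans ?_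
    have : 2 * (2 * ‖(resolv k W)⁻¹‖ * ‖(resolv k W')⁻¹‖ * ‖((W : (Matrix n n ℂ)ˣ) : Matrix n n ℂ) - W'‖)
        ≤ 2 * (2 * s⁻¹ * s⁻¹ * ‖((W : (Matrix n n ℂ)ˣ) : Matrix n n ℂ) - W'‖) := by gcongr
    exact this.trans (le_of_eq (by ring))
  equiv := fun W hW B hB t => cpath_conj (good_unitary hW) hB (good_isUnit hs hW) t
  conj_mem := fun W hW B hB => good_conj hW hB

/-! ## §2 One direction: initial margin, margin walk, spreading -/

/-- The speed constant `σ₀ = 2|n| + 8 s_n⁻¹ + 2` (uniform over `k ≤ |n|`, level `s_n∕2`). [folklore] -/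
def sigma0 (n : Type*) [Fintype n] : ℝ := 2 * (Fintype.card n : ℝ) + 8 * (marginConst n)⁻¹ + 2

/-- The Lipschitz constant `Λ₀ = 16 s_n⁻²` (level `s_n∕2`). [folklore] -/
def Lambda0 (n : Type*) [Fintype n] : ℝ := 16 * (marginConst n)⁻¹ ^ 2

omit [DecidableEq n] [Nonempty n] in
/-- `0 ≤ σ₀`, `0 ≤ Λ₀`. [folklore] -/
theorem sigma0_nonneg : 0 ≤ sigma0 n ∧ 0 ≤ Lambda0 n := by
  have h := (marginConst_pos (n := n)).1
  unfold sigma0 Lambda0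
  constructor <;> positivity

omit [Nonempty n] in
/-- A gauge transform by a periodic site field of a periodic configuration is periodic (as `NE3ResidualSliceRep.isPeriodicCfg_gaugeAct`, re-derived for
this import chain). [folklore] -/
theorem isPeriodicCfg_gaugeAct {u : Site 4 → (Matrix n n ℂ)ˣ} {P : ℤ} (hu : IsPeriodicSite u P) {U : Site 4 → Fin 4 → (Matrix n n ℂ)ˣ}
    (hU : IsPeriodicCfg U P) : IsPeriodicCfg (gaugeAct u U) P := by
  intro x κ μ
  simp only [gaugeAct]
  rw [hu x κ, hU x κ μ, add_right_comm, hu (x + e μ) κ]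

/-- **ONE DIRECTION**.  For a unitary `M`-periodic `V` with `SmallField V η` in the sector `8M²η ≤ s_n` and a direction `μ`, there is a unitary
`M`-periodic gauge `g` with all `μ`-bonds of `V^g` within `σ₀∕M` of `1` and every other bond within `3‖V(b, κ) − 1‖ + (1 + Λ₀)·M·η` of `1`,
`b` the base of the `μ`-line through the bond. [folklore] -/
theorem direction_step {M : ℕ} (hM : 1 ≤ M) {V : Site 4 → Fin 4 → (Matrix n n ℂ)ˣ} (hU : IsUnitaryCfg V) (hP : IsPeriodicCfg V (M : ℤ))
    {η : ℝ} (hη : 0 ≤ η) (hS : SmallField V η) (hsec : 8 * ((M : ℝ) * (M * η)) ≤ marginConst n) (μ : Fin 4) :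
    ∃ g : Site 4 → (Matrix n n ℂ)ˣ, IsUnitarySite g ∧ IsPeriodicSite g (M : ℤ) ∧
      (∀ x, ‖((gaugeAct g V x μ : (Matrix n n ℂ)ˣ) : Matrix n n ℂ) - 1‖ ≤ sigma0 n / M) ∧
      (∀ (x : Site 4) (κ : Fin 4), κ ≠ μ →
        ‖((gaugeAct g V x κ : (Matrix n n ℂ)ˣ) : Matrix n n ℂ) - 1‖
          ≤ 3 * ‖((V (lineBase M μ x) κ : (Matrix n n ℂ)ˣ) : Matrix n n ℂ) - 1‖ + (1 + Lambda0 n) * (M * η)) := by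
  have hM0 : (0 : ℝ) < M := by exact_mod_cast hM
  have hsn := (marginConst_pos (n := n))
  set s := marginConst n with hsdef
  -- initial margin at the origin, margin walk to every base point
  obtain ⟨k, hkK, hk0⟩ := exists_initial_margin (hol_mem_of hU (lineBase M μ 0) (seg μ (M : ℤ)) : holo M μ V 0 ∈ unitaryUnits (Matrix n n ℂ))
  have hall := holo_good_all (μ := μ) hM hU hP hη hS (Good (n := n) (k : ℝ)) (fun _ _ h => good_mono h) (fun _ _ hW _ hB => good_conj hW hB)
    (fun _ _ _ hW _ hW' h => good_pert hW hW' h) hk0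
  have hs2 : 0 < s / 2 := by linarith
  have hG : ∀ x, holo M μ V x ∈ Good (n := n) (k : ℝ) (s / 2) := fun x => good_mono (by linarith) (hall x)
  -- the path family on `Good k (s/2)` and its constants
  have hA := pathFamily_cpath (n := n) hM (k : ℝ) hs2
  have hσ : 2 * |(k : ℝ)| + 4 * (s / 2)⁻¹ + 2 ≤ sigma0 n := by
    rw [sigma0, ← hsdef, abs_of_nonneg (by positivity)]
    have : (k : ℝ) ≤ Fintype.card n := by exact_mod_cast hkK
    have e : (s / 2)⁻¹ = 2 * s⁻¹ := by rw [inv_div, div_eq_mul_inv, mul_comm]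
    rw [e]; linarith
  have hΛ : 4 * (s / 2)⁻¹ ^ 2 = Lambda0 n := by
    rw [Lambda0, ← hsdef, inv_div, div_eq_mul_inv]; ring
  have hΛ0 : 0 ≤ 4 * (s / 2)⁻¹ ^ 2 := by positivity
  refine ⟨spread M μ (cpath M (k : ℝ)) V, spread_unitary hA hU hG, spread_periodic hP, fun x => ?_, fun x κ hκ => ?_⟩
  · exact (spread_bond_dir hM hA hP hG x).trans (div_le_div_of_nonneg_right hσ hM0.le)
  · have h := spread_bond_transverse hM hA hU hP hη hS hΛ0 hG hκ x
    rwa [hΛ] at h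

/-! ## §3 The invariant and the four steps -/

/-- **THE INVARIANT** `Small M done δ V`: every bond that is either in an already processed direction (`done κ`) or NOT a wrap bond of its direction
(`x_κ mod M ≠ M − 1`) is within `δ` of `1`. [folklore] -/
def Small (M : ℕ) (done : Fin 4 → Prop) (δ : ℝ) (V : Site 4 → Fin 4 → (Matrix n n ℂ)ˣ) : Prop :=
  ∀ (x : Site 4) (κ : Fin 4), (done κ ∨ lineRes M κ x + 1 ≠ (M : ℤ)) → ‖((V x κ : (Matrix n n ℂ)ˣ) : Matrix n n ℂ) - 1‖ ≤ δ

omit [Fintype n] [DecidableEq n] [Nonempty n] in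
/-- The base of the `μ`-line has the same `κ`-residue for `κ ≠ μ`. [folklore] -/
theorem lineRes_lineBase {M : ℕ} {μ κ : Fin 4} (hκ : κ ≠ μ) (x : Site 4) : lineRes M κ (lineBase M μ x) = lineRes M κ x := by
  simp [lineRes, lineBase, e, hκ]

/-- **ONE STEP OF THE ITERATION**: `Small M done δ V ⟹ Small M (done ∪ {μ}) (3δ + (1 + Λ₀)Mη + σ₀∕M) (V^g)` with the gauge of `direction_step`.
[folklore] -/
theorem small_step {M : ℕ} (hM : 1 ≤ M) {V : Site 4 → Fin 4 → (Matrix n n ℂ)ˣ} (hU : IsUnitaryCfg V) (hP : IsPeriodicCfg V (M : ℤ))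
    {η : ℝ} (hη : 0 ≤ η) (hS : SmallField V η) (hsec : 8 * ((M : ℝ) * (M * η)) ≤ marginConst n) (μ : Fin 4)
    {done : Fin 4 → Prop} {δ : ℝ} (hδ : 0 ≤ δ) (hV : Small M done δ V) :
    ∃ g : Site 4 → (Matrix n n ℂ)ˣ, IsUnitarySite g ∧ IsPeriodicSite g (M : ℤ) ∧
      Small M (fun κ => done κ ∨ κ = μ) (3 * δ + (1 + Lambda0 n) * (M * η) + sigma0 n / M) (gaugeAct g V) := by
  obtain ⟨g, hg, hgP, hdir, htr⟩ := direction_step hM hU hP hη hS hsec μ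
  have hM0 : (0 : ℝ) < M := by exact_mod_cast hM
  have hc := sigma0_nonneg (n := n)
  have h1 : 0 ≤ (1 + Lambda0 n) * (M * η) := by have := hc.2; positivity
  have h2 : 0 ≤ sigma0 n / M := div_nonneg hc.1 hM0.le
  refine ⟨g, hg, hgP, fun x κ hxκ => ?_⟩
  by_cases hκ : κ = μ
  · subst hκ
    exact (hdir x).trans (by linarith)
  · have hb : ‖((V (lineBase M μ x) κ : (Matrix n n ℂ)ˣ) : Matrix n n ℂ) - 1‖ ≤ δ := by
      apply hV
      rcases hxκ with (h | h) | h
      · exact Or.inl h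
      · exact absurd h hκ
      · right; rwa [lineRes_lineBase hκ]
    calc _ ≤ 3 * ‖((V (lineBase M μ x) κ : (Matrix n n ℂ)ˣ) : Matrix n n ℂ) - 1‖ + (1 + Lambda0 n) * (M * η) := htr x κ hκ
      _ ≤ 3 * δ + (1 + Lambda0 n) * (M * η) + sigma0 n / M := by linarith [mul_le_mul_of_nonneg_left hb (by norm_num : (0 : ℝ) ≤ 3)]

omit [Nonempty n] in
/-- Composition of gauge transformations: `V^{w·u} = (V^u)^w` (as `NE7EtaBackgroundCarrier.gaugeAct_mul'`, re-derived for this import chain).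
[cite: Balaban1985Averaging, (8) p.18] -/
theorem gaugeAct_mul (w u : Site 4 → (Matrix n n ℂ)ˣ) (V : Site 4 → Fin 4 → (Matrix n n ℂ)ˣ) :
    gaugeAct (w * u) V = gaugeAct w (gaugeAct u V) := by
  funext x μ
  simp only [gaugeAct, Pi.mul_apply, mul_inv_rev, mul_assoc]

/-- **THE FOUR STEPS** from the comb gauge: a unitary `M`-periodic gauge `u` with EVERY bond of `U^u` within
`(243 + 40(1 + Λ₀))·M·η + 40σ₀∕M` of `1`. [folklore] -/
theorem four_steps {M : ℕ} (hM : 1 ≤ M) {U : Site 4 → Fin 4 → (Matrix n n ℂ)ˣ} (hU : IsUnitaryCfg U) (hP : IsPeriodicCfg U (M : ℤ))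
    {η : ℝ} (hη : 0 ≤ η) (hS : SmallField U η) (hsec : 8 * ((M : ℝ) * (M * η)) ≤ marginConst n) :
    ∃ u : Site 4 → (Matrix n n ℂ)ˣ, IsUnitarySite u ∧ IsPeriodicSite u (M : ℤ) ∧
      ∀ (x : Site 4) (κ : Fin 4), ‖((gaugeAct u U x κ : (Matrix n n ℂ)ˣ) : Matrix n n ℂ) - 1‖
        ≤ (243 + 40 * (1 + Lambda0 n)) * (M * η) + 40 * (sigma0 n / M) := by
  have hM0 : (0 : ℝ) < M := by exact_mod_cast hM
  have hc := sigma0_nonneg (n := n)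
  have hMη : 0 ≤ (M : ℝ) * η := by positivity
  set c₁ : ℝ := (1 + Lambda0 n) * (M * η) + sigma0 n / M with hc₁
  have hc₁0 : 0 ≤ c₁ := by have := hc.1; have := hc.2; positivity
  -- step 0: the comb gauge
  obtain ⟨hu0, hu0P, hbox⟩ := comb_gauge_box hU hη hS M
  set u₀ := TorusGaugeComb.combGaugePer M U
  set V₀ := gaugeAct u₀ U with hV₀
  have hV₀u : IsUnitaryCfg V₀ := isUnitaryCfg_gaugeAct hu0 hU
  have hV₀P : IsPeriodicCfg V₀ (M : ℤ) := isPeriodicCfg_gaugeAct hu0P hP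
  have hV₀S : SmallField V₀ η := smallField_gaugeAct hu0 hS
  have hsmall₀ : Small M (fun _ => False) (3 * (M * η)) V₀ := by
    intro x κ hxκ
    rcases hxκ with h | h
    · exact h.elim
    · -- periodic reduction to the box statement of brick B1
      revert h
      refine periodic_reduce hM (p := fun z => lineRes M κ z + 1 ≠ (M : ℤ) → ‖((V₀ z κ : (Matrix n n ℂ)ˣ) : Matrix n n ℂ) - 1‖ ≤ 3 * (M * η))
        (fun z i => by rw [(lineRes_add_period z i).1, hV₀P z i κ]) (fun y hy hyk => ?_) x
      have hyκ : y κ + 1 < M := by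
        have h1 : y κ + 1 ≤ M := hy κ
        rcases lt_or_eq_of_le h1 with h | h
        · exact h
        · exfalso; apply hyk
          simp only [lineRes, natSite]
          rw [Int.emod_eq_of_lt (by positivity) (by exact_mod_cast hy κ)]
          exact_mod_cast h
      exact (hbox y κ hy hyκ).trans (by nlinarith)
  -- steps 1–4
  obtain ⟨g₀, hg₀, hg₀P, hs₁⟩ := small_step hM hV₀u hV₀P hη hV₀S hsec 0 (by positivity) hsmall₀
  have hV₁u := isUnitaryCfg_gaugeAct hg₀ hV₀u
  have hV₁P := isPeriodicCfg_gaugeAct hg₀P hV₀P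
  have hV₁S : SmallField (gaugeAct g₀ V₀) η := smallField_gaugeAct hg₀ hV₀S
  have hδ₁ : 0 ≤ 3 * (3 * (M * η)) + (1 + Lambda0 n) * (M * η) + sigma0 n / M := by have := hc.1; have := hc.2; positivity
  obtain ⟨g₁, hg₁, hg₁P, hs₂⟩ := small_step hM hV₁u hV₁P hη hV₁S hsec 1 hδ₁ hs₁
  have hV₂u := isUnitaryCfg_gaugeAct hg₁ hV₁u
  have hV₂P := isPeriodicCfg_gaugeAct hg₁P hV₁P
  have hV₂S : SmallField (gaugeAct g₁ (gaugeAct g₀ V₀)) η := smallField_gaugeAct hg₁ hV₁S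
  have hδ₂ : 0 ≤ 3 * (3 * (3 * (M * η)) + (1 + Lambda0 n) * (M * η) + sigma0 n / M) + (1 + Lambda0 n) * (M * η) + sigma0 n / M := by
    have := hc.1; have := hc.2; positivity
  obtain ⟨g₂, hg₂, hg₂P, hs₃⟩ := small_step hM hV₂u hV₂P hη hV₂S hsec 2 hδ₂ hs₂
  have hV₃u := isUnitaryCfg_gaugeAct hg₂ hV₂u
  have hV₃P := isPeriodicCfg_gaugeAct hg₂P hV₂P
  have hV₃S : SmallField (gaugeAct g₂ (gaugeAct g₁ (gaugeAct g₀ V₀))) η := smallField_gaugeAct hg₂ hV₂S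
  have hδ₃ : 0 ≤ 3 * (3 * (3 * (3 * (M * η)) + (1 + Lambda0 n) * (M * η) + sigma0 n / M) + (1 + Lambda0 n) * (M * η) + sigma0 n / M)
      + (1 + Lambda0 n) * (M * η) + sigma0 n / M := by
    have := hc.1; have := hc.2; positivity
  obtain ⟨g₃, hg₃, hg₃P, hs₄⟩ := small_step hM hV₃u hV₃P hη hV₃S hsec 3 hδ₃ hs₃
  refine ⟨g₃ * (g₂ * (g₁ * (g₀ * u₀))), ?_, ?_, fun x κ => ?_⟩
  · exact fun x => (unitaryUnits _).mul_mem (hg₃ x) ((unitaryUnits _).mul_mem (hg₂ x) ((unitaryUnits _).mul_mem (hg₁ x)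
      ((unitaryUnits _).mul_mem (hg₀ x) (hu0 x))))
  · intro x i
    simp only [Pi.mul_apply, hg₃P x i, hg₂P x i, hg₁P x i, hg₀P x i, hu0P x i]
  · rw [gaugeAct_mul, gaugeAct_mul, gaugeAct_mul, gaugeAct_mul]
    have hdone : ((((False ∨ κ = 0) ∨ κ = 1) ∨ κ = 2) ∨ κ = 3) ∨ lineRes M κ x + 1 ≠ (M : ℤ) := by
      left; fin_cases κ <;> simp
    refine (hs₄ x κ hdone).trans (le_of_eq ?_)
    ring

/-! ## §4 The requested lemma -/

/-- The sector constant `c₀(n) = |n| ∕ (8(|n| + 1)²) > 0`. [folklore] -/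
def sectorConst (n : Type*) [Fintype n] : ℝ := (Fintype.card n : ℝ) / 8 * marginConst n

/-- The final constant `C(n) = 2·(243 + 40(1 + Λ₀) + 40σ₀)`. [folklore] -/
def gaugeConst (n : Type*) [Fintype n] : ℝ := 2 * (243 + 40 * (1 + Lambda0 n) + 40 * sigma0 n)

omit [DecidableEq n] in
/-- `0 < c₀(n)` and `0 ≤ C(n)`. [folklore] -/
theorem sectorConst_pos : 0 < sectorConst n ∧ 0 ≤ gaugeConst n := by
  have hsn := (marginConst_pos (n := n))
  have hc := sigma0_nonneg (n := n)
  have hK1 : (1 : ℝ) ≤ Fintype.card n := by exact_mod_cast Fintype.card_pos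
  refine ⟨?_, ?_⟩
  · unfold sectorConst
    exact mul_pos (by positivity) hsn.1
  · unfold gaugeConst
    nlinarith [hc.1, hc.2]

/-- **THE REQUESTED LATTICE LEMMA WITH NAMED CONSTANTS**: for `M ≥ 1`, `η ≥ 0` with `|n|·M²·η ≤ c₀(n) = sectorConst n`, every unitary `M`-periodic
`U : ℤ⁴ → U(n)` with `SmallField U η` admits a unitary `M`-periodic gauge `u` and `A` with `U^u(x, κ) = exp (A x κ)` and
`‖A x κ‖ ≤ gaugeConst n · (M⁻¹ + M·η)`.  Proof: comb gauge (B1) + four holonomy-spreading steps (B3b) along Cayley paths (B2b) on resolvent sectors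
chosen by pigeonhole and propagated across the torus (B2c), then the logarithm of a unitary matrix (`MatrixLog.exists_isHermitian_exp_eq`).
NOT a statement of Bałaban's. [folklore] -/
theorem torusSmallFieldGlobalGauge_explicit {M : ℕ} (hM : 1 ≤ M) {η : ℝ} (hη : 0 ≤ η)
    (hsec : (Fintype.card n : ℝ) * (M : ℝ) ^ 2 * η ≤ sectorConst n) {U : Site 4 → Fin 4 → (Matrix n n ℂ)ˣ} (hU : IsUnitaryCfg U)
    (hP : IsPeriodicCfg U (M : ℤ)) (hS : SmallField U η) :
    ∃ u : Site 4 → (Matrix n n ℂ)ˣ, IsUnitarySite u ∧ IsPeriodicSite u (M : ℤ) ∧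
      ∃ A : Site 4 → Fin 4 → Matrix n n ℂ, ∀ (x : Site 4) (κ : Fin 4),
        ((gaugeAct u U x κ : (Matrix n n ℂ)ˣ) : Matrix n n ℂ) = exp (A x κ) ∧ ‖A x κ‖ ≤ gaugeConst n * (((M : ℝ))⁻¹ + (M : ℝ) * η) := by
  have hsn := (marginConst_pos (n := n))
  have hc := sigma0_nonneg (n := n)
  have hK1 : (1 : ℝ) ≤ Fintype.card n := by exact_mod_cast Fintype.card_pos
  have hM0 : (0 : ℝ) < M := by exact_mod_cast hM
  -- the sector condition in the form `8 M² η ≤ s_n`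
  have hsec' : 8 * ((M : ℝ) * (M * η)) ≤ marginConst n := by
    unfold sectorConst at hsec
    have h1 : (M : ℝ) ^ 2 * η ≤ marginConst n / 8 := by
      have h2 : (Fintype.card n : ℝ) * ((M : ℝ) ^ 2 * η) ≤ (Fintype.card n : ℝ) * (marginConst n / 8) := by
        calc _ = (Fintype.card n : ℝ) * (M : ℝ) ^ 2 * η := by ring
          _ ≤ (Fintype.card n : ℝ) / 8 * marginConst n := hsec
          _ = _ := by ring
      exact le_of_mul_le_mul_left h2 (by linarith)
    nlinarith
  obtain ⟨u, hu, huP, hbd⟩ := four_steps hM hU hP hη hS hsec'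
  refine ⟨u, hu, huP, ?_⟩
  -- the logarithm bond by bond
  have hlog : ∀ (x : Site 4) (κ : Fin 4), ∃ A : Matrix n n ℂ, ((gaugeAct u U x κ : (Matrix n n ℂ)ˣ) : Matrix n n ℂ) = exp A ∧
      ‖A‖ ≤ gaugeConst n * (((M : ℝ))⁻¹ + (M : ℝ) * η) := by
    intro x κ
    have hux : gaugeAct u U x κ ∈ unitaryUnits (Matrix n n ℂ) := isUnitaryCfg_gaugeAct hu hU x κ
    obtain ⟨A, -, -, hexp, -, hle⟩ := MatrixLog.exists_isHermitian_exp_eq (mem_unitaryUnits.mp hux)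
    refine ⟨I • A, hexp.symm, ?_⟩
    rw [norm_smul, Complex.norm_I, one_mul]
    refine hle.trans ?_
    rw [UnitaryModel.opDist1]
    refine (mul_le_mul_of_nonneg_left (hbd x κ) (by positivity)).trans ?_
    have hπ : Real.pi / 2 ≤ 2 := by linarith [Real.pi_lt_four]
    have hpos : 0 ≤ (243 + 40 * (1 + Lambda0 n)) * (M * η) + 40 * (sigma0 n / M) := by have := hc.1; have := hc.2; positivity
    calc Real.pi / 2 * ((243 + 40 * (1 + Lambda0 n)) * (M * η) + 40 * (sigma0 n / M))
        ≤ 2 * ((243 + 40 * (1 + Lambda0 n)) * (M * η) + 40 * (sigma0 n / M)) := mul_le_mul_of_nonneg_right hπ hpos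
      _ ≤ gaugeConst n * (((M : ℝ))⁻¹ + (M : ℝ) * η) := by
          unfold gaugeConst
          have h1 : 0 ≤ (M : ℝ)⁻¹ := by positivity
          have h2 : 0 ≤ (M : ℝ) * η := by positivity
          have := hc.1; have := hc.2
          rw [div_eq_mul_inv]
          nlinarith
  choose A hA using hlog
  exact ⟨A, hA⟩

/-- **THE REQUESTED LATTICE LEMMA `torusSmallFieldGlobalGauge`** (INTERFACE REQUEST NE7, HOME/INBOX.md l.6032 — LITERALLY that type): there are
constants `c₀ > 0`, `C ≥ 0` depending on `n` only such that for every period `M ≥ 1` and plaquette radius `η ≥ 0` with `|n|·M²·η ≤ c₀`, every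
unitary `M`-periodic `U : ℤ⁴ → U(n)` with `SmallField U η` admits a unitary `M`-periodic gauge `u` and `A` with `U^u(x, κ) = exp (A x κ)` and
`‖A x κ‖ ≤ C·(M⁻¹ + M·η)` for all bonds (`c₀ = sectorConst n`, `C = gaugeConst n`, `torusSmallFieldGlobalGauge_explicit`).  NOT a statement of
Bałaban's; discharges only the letter `hglob` of `NE7EtaBackgroundGaugeLetter.hletter_of_torusGauge`. [folklore] -/
theorem torusSmallFieldGlobalGauge :
    ∃ c₀ C : ℝ, 0 < c₀ ∧ 0 ≤ C ∧ ∀ M : ℕ, 1 ≤ M → ∀ η : ℝ, 0 ≤ η → (Fintype.card n : ℝ) * (M : ℝ) ^ 2 * η ≤ c₀ →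
      ∀ U : Site 4 → Fin 4 → (Matrix n n ℂ)ˣ, IsUnitaryCfg U → IsPeriodicCfg U (M : ℤ) → SmallField U η →
        ∃ u : Site 4 → (Matrix n n ℂ)ˣ, IsUnitarySite u ∧ IsPeriodicSite u (M : ℤ) ∧
          ∃ A : Site 4 → Fin 4 → Matrix n n ℂ, ∀ (x : Site 4) (κ : Fin 4),
            ((gaugeAct u U x κ : (Matrix n n ℂ)ˣ) : Matrix n n ℂ) = exp (A x κ) ∧ ‖A x κ‖ ≤ C * (((M : ℝ))⁻¹ + (M : ℝ) * η) :=
  ⟨sectorConst n, gaugeConst n, sectorConst_pos.1, sectorConst_pos.2, fun _ hM _ hη hsec _ hU hP hS =>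
    torusSmallFieldGlobalGauge_explicit hM hη hsec hU hP hS⟩

end

end Summit.QuantumFields.BalabanUV.T4Continuum.TorusSmallFieldGlobalGauge
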